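import Summits.QuantumFields.BalabanUV.T4Continuum.Support.NE7SliceStepIdentities
import Summits.QuantumFields.BalabanUV.T4Continuum.Support.NE7GaugeStepCurlCovariance
import Summits.QuantumFields.BalabanUV.T4Continuum.Support.NE3CurlOfGaugeDir
import Summits.QuantumFields.BalabanUV.T4Continuum.Support.NE3LinearisedAverageSup
import Summits.QuantumFields.BalabanUV.T4Continuum.Support.NE3DirIterMajorant
import HarnessLib

/-!
# NE7SliceStepErrorSizes — THE SIZES OF THE ONE-STEP ERROR TERMS OF THE (S1) ITERATION IN SUP NORM (memo ROAD-G100 §2.3∕§2.6; no curved sup letter (L) used here): the bond junk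
# `‖J‖ ≤ 16384δs + 2048σδ + 6σs`, the corner junk `‖j_c‖ ≤ 4096σ·η_h`, the coarse datum `‖φ⁰ − φ¹‖ ≤ (3+12d)M·e_J + 2e_c`, and the CURL of the bond junk
# `‖curl_W J‖ ≤ 4σx′ + 4(e^{4ρ}−1)η + 2xσ` — every term carries the defect `δ`, or the product `σ·s` (gauge function × size), or the curvature

Cell `pub-balaban`, rung (B)+1 sub-cell t4, lineage `b2b-balaban-t4-ne7-p1`, generation 100 (CRUX PROVER NE7 #1 = OWNER of BINDER row NE7).  Memo `t4/b2b-balaban-t4-ne7-p1-g100/ROAD-G100.md`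
§2.6 (F3, first half).  Notation of the step (file `NE7SliceStepIdentities`): `U′^{u} = W·e^{X⁰}`, gauge function `ζ` (`‖ζ‖ ≤ σ`, `‖gaugeDir W ζ‖ ≤ δ` = the defect), `‖X⁰‖ ≤ s`, corner logs `‖h⁰‖ ≤ η_h`,
`X¹(b) := mlog(W(b)⁻¹U′^{e^{−ζ}u}(b))`, `J := X¹ − (X⁰ − gaugeDir W ζ)`, `j_c := h¹ − (h⁰ − ζ_c)`, `φ⁰ − φ¹ = −dirIter J + gaugeDir_V j_c`.  THIS FILE turns the pointwise letters
(`step_residue_le`, `corner_residue_le`, `NE7GaugeStepCurlCovariance.norm_curlAt_sub_curlAt_le_of_gaugeAct_smallField`, `NE3CurlOfGaugeDir.norm_curlAt_gaugeDir_le`,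
`NE3LinearisedAverageSup.norm_dirIter_le_sup`, `NE3DirIterMajorant.norm_gaugeDir_le`) into the sup-norm sizes the contraction (F3, second half, with (L)) consumes; the normal-part difference
`N⁰ − N¹ = rightInvW(φ⁰ − φ¹)` (`NE7RightInverseLinear`) is then sized by (R5)∕(R6′) of `NE3RightInverseLetters` directly.
WHAT ([folklore]; 0 def, 0 sorry).
§1 **`sup_step_residue_le`** (`‖J(b)‖ ≤ 16384δs + 2048σδ + 6σs`, for `σ, s ≤ 10⁻⁴`); **`sup_corner_residue_le`** (`‖j_c z‖ ≤ 4096σ·η_h`, for `σ, η_h ≤ 10⁻²`).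
§2 **`sup_dphi_le`** (multi-level small-field class, `W` periodic, `J` skew periodic, `curvSum ≤ 2L∕3`): `‖−dirIter J + gaugeDir_V j_c‖ ≤ (3+12d)·M·e_J + 2e_c`.
§3 **`curlAt_step_residue_eq`** (`curl_W J = curl_W X¹ − curl_W X⁰ + curl_W(gaugeDir W ζ)`); **`sup_curl_step_residue_le`**: `W` unitary with `SmallField W x`, `SmallField (W e^{X⁰}) x′`, `ζ` skew with
   `‖ζ‖ ≤ σ ≤ 1`, `‖X⁰‖, ‖X¹‖ ≤ ρ`, `‖X¹ − X⁰‖ ≤ η`, `μ ≠ ν`: `‖curlAt W J z μ ν‖ ≤ 2(2σ)x′ + 4(e^{4ρ} − 1)η + 2xσ` — the relative plaquettes are CONJUGATED by the step (no lattice difference of `J`).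
HONEST FRAMING (page 1): sup-norm bookkeeping of OUR objects over landed pointwise letters; nothing of Bałaban's asserted; (L), the contraction and (S1) are NOT here; NE7 NOT PROVED; spine 0∕9; finite
T⁴ rung (B)+1 — NOT infinite volume, NOT mass gap, NOT BetaPertH, NOT Clay.  Continuum YM on T⁴ ⇐ BetaPertH ∧ nine spine estimates (0/9 proved); BetaPertH ⇐ (D1) ∧ (D4) ∧ CAP+tail; G-an2-4 gates
asym, D1 and NE2/3/4.
-/

set_option autoImplicit false

open scoped BigOperators Matrix.Norms.L2Operator
open NormedSpace Finset

namespace Summit.QuantumFields.BalabanUV.T4Continuum.NE7SliceStepErrorSizes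

open Literature.MathematicalPhysics.QuantumFieldTheory.Balaban1983to89
open B7Prop1Explicit B7Prop2Explicit MatrixLog
open T4AveragingDeficitWall (IsUnitaryCfg IsSkewDir SmallField vary Ad curlAt)
open T4AveragingDeficitWallBoundary (IsPeriodicCfg)
open AveragingDeficitPeriodicCounting (IsPeriodicDir)
open AveragingDeficitMultiLevelPrep (cavgIter LevelSmall tower)
open BlockAveragePushDirGauge (gaugeDir)
open NE3EnergyShapes (IsUnitarySite)
open NE3TangentCovariantTower (dirIter)
open NE3LinearisedAverageSup (curvSum norm_dirIter_le_sup levelData)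
open NE3DirIterMajorant (norm_gaugeDir_le)
open NE3CurlOfGaugeDir (norm_curlAt_gaugeDir_le curlAt_sub)
open NE7GaugeStepCurlCovariance (norm_curlAt_sub_curlAt_le_of_gaugeAct_smallField)
open NE7SliceStepIdentities (step_rep step_residue_le corner_residue_le)
open BlockAverageLogInteraction (norm_exp_sub_one_le_two_mul)

noncomputable section

variable {d : ℕ} {n : Type*} [Fintype n] [DecidableEq n]

/-! ## §1 The bond junk and the corner junk in sup norm -/

/-- **THE BOND JUNK**: `‖X¹(b) − (X⁰(b) − gaugeDir W ζ(b))‖ ≤ 16384δs + 2048σδ + 6σs` at every bond, for `‖gaugeDir W ζ‖ ≤ δ`, `‖ζ‖ ≤ σ ≤ 10⁻⁴`, `‖X⁰‖ ≤ s ≤ 10⁻⁴`. [folklore] -/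
theorem sup_step_residue_le [Nonempty n] {W U' : Site d → Fin d → (Matrix n n ℂ)ˣ} (hW : IsUnitaryCfg W) {u : Site d → (Matrix n n ℂ)ˣ} {X : Site d → Fin d → Matrix n n ℂ}
    (hgauge : gaugeAct u U' = vary W X 1) {ζ : Site d → Matrix n n ℂ} {σ s δ : ℝ}
    (hζ : ∀ y, ‖ζ y‖ ≤ σ) (hσ : σ ≤ 1 / 10000) (hX : ∀ y κ, ‖X y κ‖ ≤ s) (hs : s ≤ 1 / 10000) (hδ : ∀ y κ, ‖gaugeDir W ζ y κ‖ ≤ δ) (y : Site d) (κ : Fin d) :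
    ‖mlog ((((W y κ)⁻¹ : (Matrix n n ℂ)ˣ) : Matrix n n ℂ) * ((gaugeAct ((fun y => expUnit (-ζ y)) * u) U' y κ : (Matrix n n ℂ)ˣ) : Matrix n n ℂ))
        - (X y κ - gaugeDir W ζ y κ)‖ ≤ 16384 * δ * s + 2048 * σ * δ + 6 * σ * s := by
  have h := step_residue_le hW hgauge (ζ := ζ) y κ ((hζ y).trans hσ) ((hζ _).trans hσ) ((hX y κ).trans hs)
  have hg0 := norm_nonneg (gaugeDir W ζ y κ)
  have hX0 := norm_nonneg (X y κ)
  have hζ0 := norm_nonneg (ζ (y + e κ))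
  have h1 : 16384 * ‖gaugeDir W ζ y κ‖ * ‖X y κ‖ ≤ 16384 * δ * s := by
    have := mul_le_mul (hδ y κ) (hX y κ) hX0 (hg0.trans (hδ y κ)); nlinarith
  have h2 : 2048 * ‖ζ (y + e κ)‖ * ‖gaugeDir W ζ y κ‖ ≤ 2048 * σ * δ := by
    have := mul_le_mul (hζ (y + e κ)) (hδ y κ) hg0 (hζ0.trans (hζ _)); nlinarith
  have h3 : 6 * ‖ζ (y + e κ)‖ * ‖X y κ‖ ≤ 6 * σ * s := by
    have := mul_le_mul (hζ (y + e κ)) (hX y κ) hX0 (hζ0.trans (hζ _)); nlinarith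
  linarith

/-- **THE CORNER JUNK**: `‖mlog(e^{−ζ(c)}u(c)) − (h⁰ − ζ(c))‖ ≤ 4096σ·η_h` for `u(c) = e^{h⁰}`, `‖ζ(c)‖ ≤ σ ≤ 10⁻²`, `‖h⁰‖ ≤ η_h ≤ 10⁻²`. [folklore] -/
theorem sup_corner_residue_le [Nonempty n] {uc : (Matrix n n ℂ)ˣ} {h0 ζc : Matrix n n ℂ} (hcorner : ((uc : (Matrix n n ℂ)ˣ) : Matrix n n ℂ) = exp h0)
    {σ η : ℝ} (hζ : ‖ζc‖ ≤ σ) (hσ : σ ≤ 1 / 100) (hh : ‖h0‖ ≤ η) (hη : η ≤ 1 / 100) :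
    ‖mlog (((expUnit (-ζc) * uc : (Matrix n n ℂ)ˣ) : Matrix n n ℂ)) - (h0 - ζc)‖ ≤ 4096 * σ * η := by
  have h := corner_residue_le hcorner (hζ.trans hσ) (hh.trans hη)
  have := mul_le_mul hζ hh (norm_nonneg _) ((norm_nonneg _).trans hζ)
  nlinarith

/-! ## §2 The coarse datum moves by the junk -/

/-- **THE COARSE DATUM**: in the multi-level small-field class at level `k+1` (`2 ≤ L`, `W` unitary `(tower L N (k+1))`-periodic, `curvSum ≤ 2L∕3`), for a skew `(tower)`-periodic bond
field `J` with `‖J‖ ≤ e_J` (`0 ≤ e_J`) and a site field `j_c` with `‖j_c‖ ≤ e_c`: `‖−dirIter J(z,κ) + gaugeDir_V j_c(z,κ)‖ ≤ (3+12d)·L^{k+1}·e_J + 2e_c`, `V = cavgIter L (k+1) W`. [folklore] -/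
theorem sup_dphi_le [Nonempty n] {L N : ℕ} [NeZero N] (hL : 2 ≤ L) (k : ℕ) {W : Site d → Fin d → (Matrix n n ℂ)ˣ} {x : ℝ}
    (hWu : IsUnitaryCfg W) (hWP : IsPeriodicCfg W ((tower L N (k + 1) : ℕ) : ℤ)) (hx : 0 ≤ x) (hs : LevelSmall d L k x) (hWx : SmallField W x)
    (hA : curvSum d L (k + 1) x ≤ 2 / 3 * L)
    {J : Site d → Fin d → Matrix n n ℂ} (hJs : IsSkewDir J) (hJP : IsPeriodicDir J ((tower L N (k + 1) : ℕ) : ℤ)) {eJ : ℝ} (heJ0 : 0 ≤ eJ) (hJ : ∀ y κ, ‖J y κ‖ ≤ eJ)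
    {jc : Site d → Matrix n n ℂ} {ec : ℝ} (hjc : ∀ z, ‖jc z‖ ≤ ec) (z : Site d) (κ : Fin d) :
    ‖-dirIter L (k + 1) W J z κ + gaugeDir (cavgIter L (k + 1) W) jc z κ‖ ≤ (3 + 12 * (d : ℝ)) * (L : ℝ) ^ (k + 1) * eJ + 2 * ec := by
  have hL1 : 1 ≤ L := by omega
  obtain ⟨hV, -, -, -⟩ := levelData hL1 hWu hx hs hWx (m := k + 1) le_rfl
  have h1 := norm_dirIter_le_sup hL k hWu hWP hx hs hWx hJs hJP heJ0 hJ hA z κ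
  have h2 := norm_gaugeDir_le hV jc z κ
  calc ‖-dirIter L (k + 1) W J z κ + gaugeDir (cavgIter L (k + 1) W) jc z κ‖
      ≤ ‖-dirIter L (k + 1) W J z κ‖ + ‖gaugeDir (cavgIter L (k + 1) W) jc z κ‖ := norm_add_le _ _
    _ ≤ (3 + 12 * (d : ℝ)) * (L : ℝ) ^ (k + 1) * eJ + 2 * ec := by
        rw [norm_neg]
        linarith [hjc z, hjc (z + e κ)]

/-! ## §3 The curl of the bond junk -/

/-- `curl_W J = curl_W X¹ − curl_W X⁰ + curl_W(gaugeDir W ζ)` for `J = X¹ − (X⁰ − gaugeDir W ζ)` (linearity of the dressed curl). [folklore] -/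
theorem curlAt_step_residue_eq (W : Site d → Fin d → (Matrix n n ℂ)ˣ) (X0 X1 : Site d → Fin d → Matrix n n ℂ) (ζ : Site d → Matrix n n ℂ) (z : Site d) (μ ν : Fin d) :
    curlAt W (fun y κ => X1 y κ - (X0 y κ - gaugeDir W ζ y κ)) z μ ν = curlAt W X1 z μ ν - curlAt W X0 z μ ν + curlAt W (gaugeDir W ζ) z μ ν := by
  rw [curlAt_sub, curlAt_sub]
  abel

/-- **THE CURL OF THE BOND JUNK**: `W` unitary with `SmallField W x`, the current representative `W e^{X⁰}` with `SmallField (vary W X⁰ 1) x′` (the pair's plaquettes), `U′^{u} = W e^{X⁰}`, `ζ` skew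
with `‖ζ‖ ≤ σ ≤ 10⁻⁴`, `‖X⁰‖ ≤ 10⁻⁴`, both representatives bounded by `ρ`, `‖X¹ − X⁰‖ ≤ η`, `μ ≠ ν`:
`‖curlAt W J z μ ν‖ ≤ 2(2σ)x′ + 4(e^{4ρ} − 1)η + 2xσ`. [folklore] -/
theorem sup_curl_step_residue_le [Nonempty n] {W U' : Site d → Fin d → (Matrix n n ℂ)ˣ} (hW : IsUnitaryCfg W) {x x' : ℝ} (hWx : SmallField W x)
    {u : Site d → (Matrix n n ℂ)ˣ} {X0 : Site d → Fin d → Matrix n n ℂ} (hgauge : gaugeAct u U' = vary W X0 1) (hx' : SmallField (vary W X0 1) x')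
    {ζ : Site d → Matrix n n ℂ} (hζs : ∀ y, ζ y ∈ skewAdjoint (Matrix n n ℂ)) {σ ρ η : ℝ} (hζ : ∀ y, ‖ζ y‖ ≤ σ) (hσ : σ ≤ 1 / 10000)
    (hX0s : ∀ y κ, ‖X0 y κ‖ ≤ 1 / 10000) (hρ₀ : ∀ y κ, ‖X0 y κ‖ ≤ ρ)
    (hρ₁ : ∀ y κ, ‖mlog ((((W y κ)⁻¹ : (Matrix n n ℂ)ˣ) : Matrix n n ℂ) * ((gaugeAct ((fun y => expUnit (-ζ y)) * u) U' y κ : (Matrix n n ℂ)ˣ) : Matrix n n ℂ))‖ ≤ ρ)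
    (hη : ∀ y κ, ‖mlog ((((W y κ)⁻¹ : (Matrix n n ℂ)ˣ) : Matrix n n ℂ) * ((gaugeAct ((fun y => expUnit (-ζ y)) * u) U' y κ : (Matrix n n ℂ)ˣ) : Matrix n n ℂ)) - X0 y κ‖ ≤ η)
    (z : Site d) {μ ν : Fin d} (hμν : μ ≠ ν) :
    ‖curlAt W (fun y κ => mlog ((((W y κ)⁻¹ : (Matrix n n ℂ)ˣ) : Matrix n n ℂ) * ((gaugeAct ((fun y => expUnit (-ζ y)) * u) U' y κ : (Matrix n n ℂ)ˣ) : Matrix n n ℂ))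
        - (X0 y κ - gaugeDir W ζ y κ)) z μ ν‖ ≤ 2 * (2 * σ) * x' + 4 * (Real.exp (4 * ρ) - 1) * η + 2 * x * σ := by
  letI : NormedAlgebra ℚ (Matrix n n ℂ) := NormedAlgebra.restrictScalars ℚ ℝ (Matrix n n ℂ)
  set X1 : Site d → Fin d → Matrix n n ℂ := fun y κ => mlog ((((W y κ)⁻¹ : (Matrix n n ℂ)ˣ) : Matrix n n ℂ)
      * ((gaugeAct ((fun y => expUnit (-ζ y)) * u) U' y κ : (Matrix n n ℂ)ˣ) : Matrix n n ℂ)) with hX1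
  rw [curlAt_step_residue_eq]
  -- the step in the chart: `W e^{X¹} = (W e^{X⁰})^{e^{−ζ}}`
  have hrep : vary W X1 1 = gaugeAct (fun y => expUnit (-ζ y)) (vary W X0 1) := by
    have h := step_rep hW hgauge (ζ := ζ) (fun y => (hζ y).trans hσ) hX0s
    have hmul : gaugeAct ((fun y => expUnit (-ζ y)) * u) U' = gaugeAct (fun y => expUnit (-ζ y)) (gaugeAct u U') := by
      funext x μ; simp only [gaugeAct, Pi.mul_apply, mul_inv_rev, mul_assoc]
    rw [hX1, ← h, hmul, hgauge]
  have hgu : IsUnitarySite (fun y => expUnit (-ζ y)) := fun y =>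
    mem_unitaryUnits.mpr (by rw [val_expUnit]; exact exp_mem_unitary_of_mem_skewAdjoint ((skewAdjoint _).neg_mem (hζs y)))
  have hγ : ∀ y, ‖((expUnit (-ζ y) : (Matrix n n ℂ)ˣ) : Matrix n n ℂ) - 1‖ ≤ 2 * σ := fun y => by
    rw [val_expUnit]
    exact (norm_exp_sub_one_le_two_mul (Y := -ζ y) (r := σ) (by rw [norm_neg]; exact hζ y) (hσ.trans (by norm_num))).1
  have h1 := norm_curlAt_sub_curlAt_le_of_gaugeAct_smallField hW hgu hrep hx' hγ hρ₀ hρ₁ hη z hμν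
  have h2 := norm_curlAt_gaugeDir_le hW hWx ζ z hμν
  have hx0 : 0 ≤ x := (norm_nonneg _).trans (hWx z μ ν hμν)
  calc ‖curlAt W X1 z μ ν - curlAt W X0 z μ ν + curlAt W (gaugeDir W ζ) z μ ν‖
      ≤ ‖curlAt W X1 z μ ν - curlAt W X0 z μ ν‖ + ‖curlAt W (gaugeDir W ζ) z μ ν‖ := norm_add_le _ _
    _ ≤ 2 * (2 * σ) * x' + 4 * (Real.exp (4 * ρ) - 1) * η + 2 * x * σ := by
        have h3 : 2 * x * ‖ζ z‖ ≤ 2 * x * σ := mul_le_mul_of_nonneg_left (hζ z) (by positivity)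
        linarith

end

end Summit.QuantumFields.BalabanUV.T4Continuum.NE7SliceStepErrorSizes
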